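import Summits.ValiantsHypothesis.ValiantsHypothesis.Theorems.LacunarySymmetroidMatrixDescartesDoorA26WallBubblingWeylQuadHeads

/-!
# Wall bubbling for `DoorA26` — WEYL QUINTUPLES: heads of the low class moments and TWO kernel vectors of a five-letter frame

HONEST FRAMING.  Chain lemmas toward `TripleStratum26` of `Cruxes/DoorA26/Lines/wall_bubbling_ConfluentDoor.lean` (rev 13; crux `DoorA26`,
stmt-ValiantsHypothesis-19979 — OPEN, typed, never asserted), pattern [5,1] (a quintuple is a triple).  W1 seat val-sym-door-p2 g15 (#99).
ALGEBRA ONLY (def-free), inputs of the five-letter rigidity dichotomy (#101 `…WeylQuintDichotomy`):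

* `quintHead_filter`, `quintHead_eval` — the HEAD index sets `{i ≤ m : i < 5 ∧ m − i < 5}` of #92 `blockMoment_head` for `m ≤ 8` and `m = 14`, and the
  heads written out: `G₀₀`, `2G₀₁`, `2G₀₂+2G₁₁`, `2G₀₃+6G₁₂`, `2G₀₄+8G₁₃+6G₂₂`, `10G₁₄+20G₂₃`, `30G₂₄+20G₃₃`, `70G₃₄`, `70G₄₄`, and `0` for `m = 14`
  (the slots `M₉ … M₁₄` of the fifteen-member class have NO head);
* `symm_frame_two_kernel` — five symmetric `2 × 2` real matrices carry TWO kernel relations `c, d` normalised à la Plücker: `|c_k|, |d_k| ≤ 1` and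
  `c_i = 1, c_j = 0, d_i = 0, d_j = 1` for some `i, j` (so `c, d` stay independent in any limit), with `Σ_k c_k·polar(Y, T_k) = Σ_k d_k·polar(Y, T_k) = 0`.

Nothing here bears on `DoorA26`, `MatrixDescartes` (stmt-ValiantsHypothesis-18050) or `VP ≠ VNP`; `TripleStratum26`, (W), (M) OPEN.
`--supports stmt-ValiantsHypothesis-19979 --as helper`.  [folklore].
-/

-- `Summit.ValiantsHypothesis.ValiantsHypothesis.…` repeats a component by the D-0017 layout
-- (single-conjunct summit), which the `dupNamespace` linter flags; the name is mandated.
set_option linter.dupNamespace false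

namespace Summit.ValiantsHypothesis.ValiantsHypothesis.Theorems.LacunarySymmetroidMatrixDescartes.WallBubbling

open Finset Filter Topology
open Bubbling (polar polar_apply)
open scoped BigOperators

/-! ## 1. The heads of the low moments of a five-letter block -/

/-- The head index sets `{i ≤ m : i < 5 ∧ m − i < 5}` for `m ≤ 8` and `m = 14`. [folklore] -/
theorem quintHead_filter :
    ((Finset.range 1).filter (fun i => i < 5 ∧ 0 - i < 5) = {0}) ∧
    ((Finset.range 2).filter (fun i => i < 5 ∧ 1 - i < 5) = {0, 1}) ∧
    ((Finset.range 3).filter (fun i => i < 5 ∧ 2 - i < 5) = {0, 1, 2}) ∧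
    ((Finset.range 4).filter (fun i => i < 5 ∧ 3 - i < 5) = {0, 1, 2, 3}) ∧
    ((Finset.range 5).filter (fun i => i < 5 ∧ 4 - i < 5) = {0, 1, 2, 3, 4}) ∧
    ((Finset.range 6).filter (fun i => i < 5 ∧ 5 - i < 5) = {1, 2, 3, 4}) ∧
    ((Finset.range 7).filter (fun i => i < 5 ∧ 6 - i < 5) = {2, 3, 4}) ∧
    ((Finset.range 8).filter (fun i => i < 5 ∧ 7 - i < 5) = {3, 4}) ∧
    ((Finset.range 9).filter (fun i => i < 5 ∧ 8 - i < 5) = {4}) ∧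
    ((Finset.range 15).filter (fun i => i < 5 ∧ 14 - i < 5) = ∅) := by
  refine ⟨by decide, by decide, by decide, by decide, by decide, by decide, by decide, by decide, by decide, by decide⟩

/-- The heads written out: `m = 0..8` and `14`, for any symmetric kernel `G`. [folklore] -/
theorem quintHead_eval (G : ℕ → ℕ → ℝ) (hG : ∀ i j, G i j = G j i) :
    (∑ i ∈ (Finset.range 1).filter (fun i => i < 5 ∧ 0 - i < 5), ((0 : ℕ).choose i : ℝ) * G i (0 - i)) = G 0 0 ∧
    (∑ i ∈ (Finset.range 2).filter (fun i => i < 5 ∧ 1 - i < 5), ((1 : ℕ).choose i : ℝ) * G i (1 - i)) = 2 * G 0 1 ∧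
    (∑ i ∈ (Finset.range 3).filter (fun i => i < 5 ∧ 2 - i < 5), ((2 : ℕ).choose i : ℝ) * G i (2 - i)) = 2 * G 0 2 + 2 * G 1 1 ∧
    (∑ i ∈ (Finset.range 4).filter (fun i => i < 5 ∧ 3 - i < 5), ((3 : ℕ).choose i : ℝ) * G i (3 - i)) = 2 * G 0 3 + 6 * G 1 2 ∧
    (∑ i ∈ (Finset.range 5).filter (fun i => i < 5 ∧ 4 - i < 5), ((4 : ℕ).choose i : ℝ) * G i (4 - i))
        = 2 * G 0 4 + 8 * G 1 3 + 6 * G 2 2 ∧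
    (∑ i ∈ (Finset.range 6).filter (fun i => i < 5 ∧ 5 - i < 5), ((5 : ℕ).choose i : ℝ) * G i (5 - i)) = 10 * G 1 4 + 20 * G 2 3 ∧
    (∑ i ∈ (Finset.range 7).filter (fun i => i < 5 ∧ 6 - i < 5), ((6 : ℕ).choose i : ℝ) * G i (6 - i)) = 30 * G 2 4 + 20 * G 3 3 ∧
    (∑ i ∈ (Finset.range 8).filter (fun i => i < 5 ∧ 7 - i < 5), ((7 : ℕ).choose i : ℝ) * G i (7 - i)) = 70 * G 3 4 ∧
    (∑ i ∈ (Finset.range 9).filter (fun i => i < 5 ∧ 8 - i < 5), ((8 : ℕ).choose i : ℝ) * G i (8 - i)) = 70 * G 4 4 ∧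
    (∑ i ∈ (Finset.range 15).filter (fun i => i < 5 ∧ 14 - i < 5), ((14 : ℕ).choose i : ℝ) * G i (14 - i)) = 0 := by
  obtain ⟨h0, h1, h2, h3, h4, h5, h6, h7, h8, h14⟩ := quintHead_filter
  have c42 : ((4 : ℕ).choose 2 : ℝ) = 6 := by norm_num [Nat.choose]
  have c52 : ((5 : ℕ).choose 2 : ℝ) = 10 := by norm_num [Nat.choose]
  have c53 : ((5 : ℕ).choose 3 : ℝ) = 10 := by norm_num [Nat.choose]
  have c62 : ((6 : ℕ).choose 2 : ℝ) = 15 := by norm_num [Nat.choose]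
  have c63 : ((6 : ℕ).choose 3 : ℝ) = 20 := by norm_num [Nat.choose]
  have c64 : ((6 : ℕ).choose 4 : ℝ) = 15 := by norm_num [Nat.choose]
  have c73 : ((7 : ℕ).choose 3 : ℝ) = 35 := by norm_num [Nat.choose]
  have c74 : ((7 : ℕ).choose 4 : ℝ) = 35 := by norm_num [Nat.choose]
  have c84 : ((8 : ℕ).choose 4 : ℝ) = 70 := by norm_num [Nat.choose]
  refine ⟨?_, ?_, ?_, ?_, ?_, ?_, ?_, ?_, ?_, ?_⟩
  · rw [h0, Finset.sum_singleton]; simp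
  · rw [h1, Finset.sum_insert (by decide), Finset.sum_singleton]; simp [hG 1 0]; ring
  · rw [h2, Finset.sum_insert (by decide), Finset.sum_insert (by decide), Finset.sum_singleton]
    simp [hG 2 0]; ring
  · rw [h3, Finset.sum_insert (by decide), Finset.sum_insert (by decide), Finset.sum_insert (by decide), Finset.sum_singleton]
    simp [hG 3 0, hG 2 1]; ring
  · rw [h4, Finset.sum_insert (by decide), Finset.sum_insert (by decide), Finset.sum_insert (by decide),
      Finset.sum_insert (by decide), Finset.sum_singleton]
    simp [hG 4 0, hG 3 1, c42]; ring
  · rw [h5, Finset.sum_insert (by decide), Finset.sum_insert (by decide), Finset.sum_insert (by decide), Finset.sum_singleton]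
    simp [hG 4 1, hG 3 2, c52, c53]; ring
  · rw [h6, Finset.sum_insert (by decide), Finset.sum_insert (by decide), Finset.sum_singleton]
    simp [hG 4 2, c62, c63, c64]; ring
  · rw [h7, Finset.sum_insert (by decide), Finset.sum_singleton]
    simp [hG 4 3, c73, c74]; ring
  · rw [h8, Finset.sum_singleton]
    simp [c84]
  · rw [h14, Finset.sum_empty]

/-! ## 2. Five symmetric matrices carry two independent relations -/

/-- **Two kernel vectors of a five-letter symmetric frame, Plücker-normalised.**  For symmetric `T₀..T₄ ∈ M₂(ℝ)` (a 3-space) there are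
`c, d : Fin 5 → ℝ` with `|c_k|, |d_k| ≤ 1`, `c_i = 1, c_j = 0, d_i = 0, d_j = 1` for some `i, j`, and `Σ_k c_k·polar(Y,T_k) = Σ_k d_k·polar(Y,T_k) = 0`
for every `Y`.  (Two relations from #93a `symm_frame_dependent` on four of the letters, then division by the largest `2 × 2` minor.) [folklore] -/
theorem symm_frame_two_kernel (T : Fin 5 → Matrix (Fin 2) (Fin 2) ℝ) (hT : ∀ i, (T i).IsSymm) :
    ∃ c d : Fin 5 → ℝ, (∀ k, |c k| ≤ 1) ∧ (∀ k, |d k| ≤ 1) ∧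
      (∃ i j : Fin 5, c i = 1 ∧ c j = 0 ∧ d i = 0 ∧ d j = 1) ∧
      (∀ Y : Matrix (Fin 2) (Fin 2) ℝ, ∑ k, c k * polar Y (T k) = 0) ∧
      (∀ Y : Matrix (Fin 2) (Fin 2) ℝ, ∑ k, d k * polar Y (T k) = 0) := by
  classical
  -- first relation: on the letters `0,1,2,3`
  obtain ⟨g', hg'le, ⟨p, hp⟩, hg'⟩ := symm_frame_dependent (fun i : Fin 4 => T i.castSucc) (fun i => hT _)
  set g : Fin 5 → ℝ := fun k => ∑ i : Fin 4, if i.castSucc = k then g' i else 0 with hg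
  have hg_cast : ∀ i : Fin 4, g i.castSucc = g' i := by
    intro i
    simp only [hg]
    rw [Finset.sum_eq_single i (fun b _ hb => by rw [if_neg (fun h => hb (Fin.castSucc_injective _ h))]) (by simp)]
    rw [if_pos rfl]
  have hg_last : g (Fin.last 4) = 0 := by
    simp only [hg]
    exact Finset.sum_eq_zero fun i _ => by rw [if_neg (Fin.castSucc_lt_last i).ne]
  have hgrel : ∀ Y, ∑ k, g k * polar Y (T k) = 0 := by
    intro Y
    rw [Fin.sum_univ_castSucc, hg_last, zero_mul, add_zero]
    simp only [hg_cast]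
    exact hg' Y
  -- second relation: on the four letters other than `P = p.castSucc`
  obtain ⟨h', hh'le, ⟨q, hq⟩, hh'⟩ := symm_frame_dependent (fun i : Fin 4 => T ((p.castSucc : Fin 5).succAbove i)) (fun i => hT _)
  set h : Fin 5 → ℝ := fun k => ∑ i : Fin 4, if (p.castSucc : Fin 5).succAbove i = k then h' i else 0 with hh
  have hh_sa : ∀ i : Fin 4, h ((p.castSucc : Fin 5).succAbove i) = h' i := by
    intro i
    simp only [hh]
    rw [Finset.sum_eq_single i (fun b _ hb => by rw [if_neg (fun e => hb (Fin.succAbove_right_injective e))]) (by simp)]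
    rw [if_pos rfl]
  have hh_P : h (p.castSucc : Fin 5) = 0 := by
    simp only [hh]
    exact Finset.sum_eq_zero fun i _ => by rw [if_neg (Fin.succAbove_ne _ i)]
  have hhrel : ∀ Y, ∑ k, h k * polar Y (T k) = 0 := by
    intro Y
    rw [Fin.sum_univ_succAbove _ (p.castSucc : Fin 5), hh_P, zero_mul, zero_add]
    simp only [hh_sa]
    exact hh' Y
  -- the `2 × 2` minors and the largest one
  set Q : Fin 5 × Fin 5 → ℝ := fun ij => g ij.1 * h ij.2 - g ij.2 * h ij.1 with hQ
  have hQval : Q ((p.castSucc : Fin 5), (p.castSucc : Fin 5).succAbove q) = g' p * h' q := by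
    simp only [hQ]
    rw [hh_P, hh_sa, hg_cast, mul_zero, sub_zero]
  have hQne : Q ((p.castSucc : Fin 5), (p.castSucc : Fin 5).succAbove q) ≠ 0 := by
    rw [hQval]
    intro h0
    rcases mul_eq_zero.mp h0 with h1 | h1
    · rw [h1, abs_zero] at hp; exact zero_ne_one hp
    · rw [h1, abs_zero] at hq; exact zero_ne_one hq
  set μ : ℝ := (univ : Finset (Fin 5 × Fin 5)).sup' Finset.univ_nonempty (fun ij => |Q ij|) with hμ
  have hdom : ∀ ij, |Q ij| ≤ μ := fun ij => Finset.le_sup' (fun ij => |Q ij|) (Finset.mem_univ ij)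
  obtain ⟨⟨i₀, j₀⟩, _, hij₀⟩ := Finset.exists_mem_eq_sup' (Finset.univ_nonempty (α := Fin 5 × Fin 5)) (fun ij => |Q ij|)
  have hμpos : 0 < μ := lt_of_lt_of_le (abs_pos.mpr hQne) (hdom _)
  set D : ℝ := Q (i₀, j₀) with hD
  have hDabs : |D| = μ := hij₀.symm
  have hD0 : D ≠ 0 := fun h0 => by rw [h0, abs_zero] at hDabs; exact (ne_of_gt hμpos) hDabs.symm
  refine ⟨fun k => Q (k, j₀) / D, fun k => Q (i₀, k) / D, fun k => ?_, fun k => ?_, ⟨i₀, j₀, ?_, ?_, ?_, ?_⟩, fun Y => ?_, fun Y => ?_⟩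
  · rw [abs_div, hDabs, div_le_one hμpos]; exact hdom _
  · rw [abs_div, hDabs, div_le_one hμpos]; exact hdom _
  · exact div_self hD0
  · simp only [hQ]; rw [sub_self, zero_div]
  · simp only [hQ]; rw [sub_self, zero_div]
  · exact div_self hD0
  · have : ∑ k, Q (k, j₀) / D * polar Y (T k) = (h j₀ * ∑ k, g k * polar Y (T k) - g j₀ * ∑ k, h k * polar Y (T k)) / D := by
      rw [Finset.mul_sum, Finset.mul_sum, ← Finset.sum_sub_distrib, Finset.sum_div]
      exact Finset.sum_congr rfl fun k _ => by simp only [hQ]; ring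
    rw [this, hgrel, hhrel, mul_zero, mul_zero, sub_zero, zero_div]
  · have : ∑ k, Q (i₀, k) / D * polar Y (T k) = (g i₀ * ∑ k, h k * polar Y (T k) - h i₀ * ∑ k, g k * polar Y (T k)) / D := by
      rw [Finset.mul_sum, Finset.mul_sum, ← Finset.sum_sub_distrib, Finset.sum_div]
      exact Finset.sum_congr rfl fun k _ => by simp only [hQ]; ring
    rw [this, hgrel, hhrel, mul_zero, mul_zero, sub_zero, zero_div]

end Summit.ValiantsHypothesis.ValiantsHypothesis.Theorems.LacunarySymmetroidMatrixDescartes.WallBubbling
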